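import Literature.NumberTheory.LFunctions.NicolasMertensRH
import Mathlib.Algebra.Order.Field.GeomSum
import Mathlib.Analysis.Complex.ExponentialBounds
import HarnessLib

/-!
# Nicolas 2012, Lemma 2.4 (2.12): `ψ(x) − θ(x) ≤ √x + (4/3) x^{1/3}` under RH

Topic: `Literature/NumberTheory/LFunctions`. J.-L. Nicolas, Acta Arith. 155 (2012), Lemma 2.4, (2.12):
under RH, `(ψ(x) − θ(x) − √x)/x^{1/3} ≤ 1.332768… ≤ 4/3` for `x ≥ 1` — the upper bound for
`ψ − θ` that enters his (2.18) (`Nicolas2012_logf_lower_sharp`, `NicolasMertensRH.lean`) through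
Cor. 2.1 (`J − K ≤ F_{1/2} + (4/3)F_{1/3}`, `NicolasK.lean`). Nicolas's proof has three cases:

* **Case 1, `1 ≤ x < 2^32`**: a finite computation over the 6948 prime powers `q_i < 2^32`
  (`G(q_i) ≤ G(283²) = 1.332768…`). Recorded as the NAMED FACT `Nicolas2012_lemma24_case1`
  (nothing asserted; a certified replay is a separate task).
* **Case 2, `x ≥ 2^32` while `θ(y) < y` is available for all `y ≤ √x`**: then
  `ψ(x) − θ(x) = ∑_{2 ≤ k ≤ κ} θ(x^{1/k}) ≤ √x + x^{1/3}(1 + ∑_{4 ≤ k ≤ κ} x^{1/k−1/3})` and the last sum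
  is `≤ 0.3289` (PROVED: `sum_rpow_sub_third_le`, `sum_Ico_4_33_le`, replacing Nicolas's
  Lemma 2.3 (i) by a direct bound). Nicolas uses Dusart's `θ(y) < y` (`y ≤ 8·10^{11}`); we use the
  published extension of Platt–Trudgian (Math. Comp. 85 (2016), Thm. 1: `θ(y) < y` for
  `0 < y ≤ 1.39·10^{17}`), recorded as the NAMED FACT `PlattTrudgian2016_theta_lt` (a finite
  interval-arithmetic computation), which covers `2^32 ≤ x ≤ 2^100` (PROVED: `psi_sub_theta_le_case2`).
* **Case 3, `x ≥ 2^100`** (Nicolas: `x ≥ 64·10^{22}`, with Lemma 2.3 (ii)): Schoenfeld's RH bound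
  `|θ(y) − y| ≤ √y log² y/(8π)` (`y ≥ 599`, the tree's named fact `Schoenfeld1976_theta`) at
  `y = √x, x^{1/3}`, Chebyshev's `θ(y) ≤ (log 4) y` for the `k ≥ 4` terms, and the same sum bound with
  `J = 100` give `ψ − θ ≤ √x + 1.17 x^{1/3}` (PROVED: `psi_sub_theta_le_case3`).

Assembled: `Nicolas2012_lemma24_upper` — under RH, from `Schoenfeld1976_theta`,
`PlattTrudgian2016_theta_lt` and `Nicolas2012_lemma24_case1`, (2.12) holds for all `x ≥ 1` with the
constant `4/3`.

## References

* J.-L. Nicolas, *Small values of the Euler function and the Riemann hypothesis*, Acta Arith. 155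
  (2012), 311–321 (arXiv:1202.0729), Lemma 2.3, Lemma 2.4 (2.11)–(2.12) and its proof (Cases 1–3).
  [Nicolas2012]
* D. J. Platt, T. S. Trudgian, *On the first sign change of θ(x) − x*, Math. Comp. 85 (2016),
  1539–1547 (arXiv:1407.1914), Theorem 1. [PlattTrudgian2016Theta]
* L. Schoenfeld, *Sharper bounds for the Chebyshev functions θ(x) and ψ(x). II*, Math. Comp. 30
  (1976), 337–360, (6.3). [Schoenfeld1976]
-/

noncomputable section

open Real Finset
open scoped Chebyshev

namespace Literature.NumberTheory.LFunctions

/-! ### The two computational named facts -/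

/-- NAMED FACT (Platt–Trudgian 2016, Theorem 1, as printed: "For `0 < x ≤ 1.39·10^{17}`,
`θ(x) < x`." — a finite computation (a rigorous sweep over the primes with interval arithmetic),
extending Schoenfeld's range `10^{11}` and Dusart's `8·10^{11}`, the latter being the input (1.13) of
Nicolas 2012). `θ = Chebyshev.theta`. Users take `(h : PlattTrudgian2016_theta_lt)`.
[cite: PlattTrudgian2016Theta, Thm. 1] -/
def PlattTrudgian2016_theta_lt : Prop :=
  ∀ x : ℝ, 0 < x → x ≤ 139 * 10 ^ 15 → θ x < x

/-- NAMED FACT (Nicolas 2012, proof of Lemma 2.4, Case 1, a finite computation: "Case 1,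
`1 ≤ x < 2^32`. The largest `q_i` smaller than `2^32` is `q_6947 = 4293001441 = 65521²`. On the
intervals `[q_i, q_{i+1})` the function `G(x) = (ψ(x) − θ(x) − √x)/x^{1/3}` is decreasing. By computing
`G(q_0), G(q_1), …, G(q_6947)` we get `G(x) ≤ G(q_103) = 1.332768…` [`q_103 = 80089 = 283²`]").
Stated with the printed decimal rounded up: for real `1 ≤ x < 2^32`,
`ψ(x) − θ(x) ≤ √x + 1.332769 · x^{1/3}` (`ψ, θ` = `Chebyshev.psi, Chebyshev.theta`). Users take
`(h : Nicolas2012_lemma24_case1)`. [cite: Nicolas2012, Lemma 2.4, proof, Case 1] -/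
def Nicolas2012_lemma24_case1 : Prop :=
  ∀ x : ℝ, 1 ≤ x → x < 2 ^ 32 → ψ x - θ x ≤ Real.sqrt x + 1.332769 * x ^ ((1 : ℝ) / 3)

namespace NicolasPsiTheta

/-! ### Numerical tools: rational bounds for `(2^J)^{1/k − 1/3}` -/

/-- `(2^J)^{1/k − 1/3} ≤ c` follows from the integer-power inequality `2^{3J} ≤ c^{3k} · 2^{Jk}`.
[folklore] -/
theorem rpow_le_of_pow_le {J k : ℕ} (hk : 0 < k) {c : ℝ} (hc : 0 < c)
    (h : ((2 : ℝ) ^ J) ^ 3 ≤ c ^ (3 * k) * ((2 : ℝ) ^ J) ^ k) :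
    ((2 : ℝ) ^ J) ^ ((1 : ℝ) / k - 1 / 3) ≤ c := by
  refine le_of_not_gt fun hlt ↦ ?_
  have hk0 : (k : ℝ) ≠ 0 := by exact_mod_cast hk.ne'
  have hb : (0 : ℝ) < (2 : ℝ) ^ J := by positivity
  have hX : (((2 : ℝ) ^ J) ^ ((1 : ℝ) / k - 1 / 3)) ^ (3 * k) = ((2 : ℝ) ^ J) ^ 3 / ((2 : ℝ) ^ J) ^ k := by
    rw [← Real.rpow_natCast _ (3 * k), ← Real.rpow_mul hb.le]
    have : ((1 : ℝ) / k - 1 / 3) * ((3 * k : ℕ) : ℝ) = ((3 : ℕ) : ℝ) - ((k : ℕ) : ℝ) := by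
      push_cast
      field_simp
    rw [this, Real.rpow_sub hb, Real.rpow_natCast, Real.rpow_natCast]
  have h1 : c ^ (3 * k) < (((2 : ℝ) ^ J) ^ ((1 : ℝ) / k - 1 / 3)) ^ (3 * k) :=
    pow_lt_pow_left₀ hlt hc.le (by omega)
  rw [hX, lt_div_iff₀ (by positivity)] at h1
  linarith

/-- `c ≤ (2^J)^{1/n}` follows from `c^n ≤ 2^J` (`c ≥ 0`). [folklore] -/
theorem le_rpow_of_pow_le {J n : ℕ} (hn : 0 < n) {c : ℝ}
    (h : c ^ n ≤ (2 : ℝ) ^ J) : c ≤ ((2 : ℝ) ^ J) ^ ((1 : ℝ) / n) := by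
  refine le_of_not_gt fun hlt ↦ ?_
  have hb : (0 : ℝ) ≤ (2 : ℝ) ^ J := by positivity
  have hX : (((2 : ℝ) ^ J) ^ ((1 : ℝ) / n)) ^ n = (2 : ℝ) ^ J := by
    rw [← Real.rpow_natCast _ n, ← Real.rpow_mul hb]
    have : (1 : ℝ) / n * (n : ℕ) = 1 := by
      have : (n : ℝ) ≠ 0 := by exact_mod_cast hn.ne'
      field_simp
    rw [this, Real.rpow_one]
  have h1 : (((2 : ℝ) ^ J) ^ ((1 : ℝ) / n)) ^ n < c ^ n := pow_lt_pow_left₀ hlt (by positivity) hn.ne'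
  rw [hX] at h1
  linarith

/-- `2^{−1/3} ≤ 0.794` (`0.794³ = 0.50057 > 1/2`). [folklore] -/
theorem rpow_neg_third_le : (2 : ℝ) ^ (-(1 : ℝ) / 3) ≤ 0.794 := by
  refine le_of_not_gt fun hlt ↦ ?_
  have h3 : ((2 : ℝ) ^ (-(1 : ℝ) / 3)) ^ 3 = 1 / 2 := by
    rw [← Real.rpow_natCast _ 3, ← Real.rpow_mul (by norm_num),
      show -(1 : ℝ) / 3 * ((3 : ℕ) : ℝ) = -((1 : ℕ) : ℝ) by norm_num, Real.rpow_neg (by norm_num),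
      Real.rpow_natCast]
    norm_num
  have h1 : (0.794 : ℝ) ^ 3 < ((2 : ℝ) ^ (-(1 : ℝ) / 3)) ^ 3 :=
    pow_lt_pow_left₀ hlt (by norm_num) (by norm_num)
  rw [h3] at h1
  norm_num at h1

/-- `2^{1 − k/3} = 2 · (2^{−1/3})^k`. [folklore] -/
theorem two_rpow_one_sub (k : ℕ) :
    (2 : ℝ) ^ ((1 : ℝ) - k / 3) = 2 * ((2 : ℝ) ^ (-(1 : ℝ) / 3)) ^ k := by
  rw [← Real.rpow_mul_natCast (by norm_num), Real.rpow_sub (by norm_num), Real.rpow_one,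
    show -(1 : ℝ) / 3 * k = -((k : ℝ) / 3) by ring, Real.rpow_neg (by norm_num)]
  field_simp

/-- **Geometric tail**: `∑_{M < k < N} 2^{1 − k/3} ≤ 2 · (2^{−1/3})^{M+1}/(1 − 0.794)`.
[folklore] -/
theorem sum_Ico_two_rpow_le (M N : ℕ) :
    ∑ k ∈ Finset.Ico (M + 1) N, (2 : ℝ) ^ ((1 : ℝ) - k / 3) ≤
      2 * ((2 : ℝ) ^ (-(1 : ℝ) / 3)) ^ (M + 1) / (1 - 0.794) := by
  set r := (2 : ℝ) ^ (-(1 : ℝ) / 3) with hr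
  have hr0 : 0 ≤ r := by positivity
  have hr794 : r ≤ 0.794 := rpow_neg_third_le
  have hr1 : r < 1 := by linarith
  have hgeom : ∑ k ∈ Finset.Ico (M + 1) N, r ^ k ≤ r ^ (M + 1) / (1 - r) := geom_sum_Ico_le_of_lt_one hr0 hr1
  calc ∑ k ∈ Finset.Ico (M + 1) N, (2 : ℝ) ^ ((1 : ℝ) - k / 3) = 2 * ∑ k ∈ Finset.Ico (M + 1) N, r ^ k := by
        rw [Finset.mul_sum]
        exact Finset.sum_congr rfl fun k _ ↦ two_rpow_one_sub k
    _ ≤ 2 * (r ^ (M + 1) / (1 - r)) := by linarith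
    _ ≤ 2 * (r ^ (M + 1) / (1 - 0.794)) := by
        refine mul_le_mul_of_nonneg_left ?_ (by norm_num)
        exact div_le_div_of_nonneg_left (pow_nonneg hr0 _) (by norm_num) (by linarith)
    _ = 2 * ((2 : ℝ) ^ (-(1 : ℝ) / 3)) ^ (M + 1) / (1 - 0.794) := by rw [hr]; ring

/-- `(2^{−1/3})^{33} = 2^{−11}`, so the tail beyond `k = 32` is `≤ 0.00475`. [folklore] -/
theorem tail_32_le : 2 * ((2 : ℝ) ^ (-(1 : ℝ) / 3)) ^ (32 + 1) / (1 - 0.794) ≤ 0.00475 := by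
  have : ((2 : ℝ) ^ (-(1 : ℝ) / 3)) ^ (32 + 1) = 1 / 2 ^ 11 := by
    rw [← Real.rpow_natCast _ (32 + 1), ← Real.rpow_mul (by norm_num),
      show -(1 : ℝ) / 3 * ((32 + 1 : ℕ) : ℝ) = -((11 : ℕ) : ℝ) by norm_num, Real.rpow_neg (by norm_num),
      Real.rpow_natCast]
    norm_num
  rw [this]
  norm_num

/-- The tail beyond `k = 100` is `≤ 10⁻⁸`. [folklore] -/
theorem tail_100_le : 2 * ((2 : ℝ) ^ (-(1 : ℝ) / 3)) ^ (100 + 1) / (1 - 0.794) ≤ 0.00000001 := by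
  have hr0 : 0 ≤ (2 : ℝ) ^ (-(1 : ℝ) / 3) := by positivity
  have hr1 : (2 : ℝ) ^ (-(1 : ℝ) / 3) ≤ 1 := by linarith [rpow_neg_third_le]
  have h99 : ((2 : ℝ) ^ (-(1 : ℝ) / 3)) ^ 99 = 1 / 2 ^ 33 := by
    rw [← Real.rpow_natCast _ 99, ← Real.rpow_mul (by norm_num),
      show -(1 : ℝ) / 3 * ((99 : ℕ) : ℝ) = -((33 : ℕ) : ℝ) by norm_num, Real.rpow_neg (by norm_num),
      Real.rpow_natCast]
    norm_num
  have hle : ((2 : ℝ) ^ (-(1 : ℝ) / 3)) ^ (100 + 1) ≤ 1 / 2 ^ 33 := by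
    rw [← h99]
    exact pow_le_pow_of_le_one hr0 hr1 (by norm_num)
  have : 2 * ((2 : ℝ) ^ (-(1 : ℝ) / 3)) ^ (100 + 1) / (1 - 0.794) ≤ 2 * (1 / 2 ^ 33) / (1 - 0.794) := by
    refine div_le_div_of_nonneg_right ?_ (by norm_num)
    linarith
  refine this.trans ?_
  norm_num

/-! ### The sum `S₄(t) = ∑_{4 ≤ k ≤ κ} t^{1/k − 1/3}` for `t ≥ 2^J` -/

/-- `k ≤ κ(t) = ⌊log t/log 2⌋` implies `2^k ≤ t` (`t ≥ 1`). [folklore] -/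
theorem two_pow_le_of_le_floor {t : ℝ} (ht : 1 ≤ t) {k : ℕ}
    (hk : k ≤ ⌊Real.log t / Real.log 2⌋₊) : (2 : ℝ) ^ k ≤ t := by
  have hlog2 : 0 < Real.log 2 := Real.log_pos one_lt_two
  have h0 : 0 ≤ Real.log t / Real.log 2 := div_nonneg (Real.log_nonneg ht) hlog2.le
  have h1 : (k : ℝ) ≤ Real.log t / Real.log 2 := (Nat.le_floor_iff h0).1 hk
  have h2 : (k : ℝ) * Real.log 2 ≤ Real.log t := (le_div_iff₀ hlog2).1 h1
  have h3 : Real.log ((2 : ℝ) ^ k) ≤ Real.log t := by rw [Real.log_pow]; exact h2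
  exact (Real.log_le_log_iff (by positivity) (by linarith)).1 h3

/-- `2^J ≤ t` implies `J ≤ κ(t)`. [folklore] -/
theorem le_floor_of_two_pow_le {t : ℝ} {J : ℕ} (ht : (2 : ℝ) ^ J ≤ t) :
    J ≤ ⌊Real.log t / Real.log 2⌋₊ := by
  have hlog2 : 0 < Real.log 2 := Real.log_pos one_lt_two
  have ht0 : 0 < t := lt_of_lt_of_le (by positivity) ht
  refine Nat.le_floor ?_
  rw [le_div_iff₀ hlog2]
  have := Real.log_le_log (by positivity) ht
  rwa [Real.log_pow] at this

/-- For `k ≥ 4` the exponent `1/k − 1/3` is `≤ 0`. [folklore] -/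
theorem exp_nonpos {k : ℕ} (hk : 4 ≤ k) : (1 : ℝ) / k - 1 / 3 ≤ 0 := by
  have hk0 : (0 : ℝ) < k := by exact_mod_cast (show 0 < k by omega)
  have : (1 : ℝ) / k ≤ 1 / 3 := by
    rw [div_le_div_iff₀ hk0 (by norm_num)]
    have : (3 : ℝ) ≤ k := by exact_mod_cast (show 3 ≤ k by omega)
    linarith
  linarith

/-- **The sum bound**: for `t ≥ 2^J` (`J ≥ 1`),
`∑_{4 ≤ k ≤ κ(t)} t^{1/k − 1/3} ≤ ∑_{4 ≤ k ≤ J} (2^J)^{1/k − 1/3} + 2 (2^{−1/3})^{J+1}/(1 − 0.794)`: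
terms with `k ≤ J` are non-increasing in `t`, and a term with `J < k ≤ κ` has `2^k ≤ t`, hence is
`≤ (2^k)^{1/k − 1/3} = 2^{1 − k/3}` (geometric tail). This replaces Nicolas's Lemma 2.3 (i).
[cite: Nicolas2012, Lemma 2.3 (i) and Lemma 2.4, proof, Case 2] -/
theorem sum_rpow_sub_third_le {J : ℕ} {t : ℝ} (ht : (2 : ℝ) ^ J ≤ t) :
    ∑ k ∈ Finset.Icc 4 ⌊Real.log t / Real.log 2⌋₊, t ^ ((1 : ℝ) / k - 1 / 3) ≤
      ∑ k ∈ Finset.Ico 4 (J + 1), ((2 : ℝ) ^ J) ^ ((1 : ℝ) / k - 1 / 3) +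
        2 * ((2 : ℝ) ^ (-(1 : ℝ) / 3)) ^ (J + 1) / (1 - 0.794) := by
  set κ := ⌊Real.log t / Real.log 2⌋₊ with hκ
  have hb : (0 : ℝ) < (2 : ℝ) ^ J := by positivity
  have ht1 : 1 ≤ t := le_trans (one_le_pow₀ (by norm_num)) ht
  have ht0 : 0 < t := by linarith
  rw [← Finset.sum_filter_add_sum_filter_not (Finset.Icc 4 κ) (fun k ↦ k ≤ J)]
  refine add_le_add ?_ ?_
  · calc ∑ k ∈ (Finset.Icc 4 κ).filter (fun k ↦ k ≤ J), t ^ ((1 : ℝ) / k - 1 / 3)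
        ≤ ∑ k ∈ (Finset.Icc 4 κ).filter (fun k ↦ k ≤ J), ((2 : ℝ) ^ J) ^ ((1 : ℝ) / k - 1 / 3) := by
          refine Finset.sum_le_sum fun k hk ↦ ?_
          have hk4 : 4 ≤ k := (Finset.mem_Icc.1 (Finset.mem_filter.1 hk).1).1
          exact Real.rpow_le_rpow_of_nonpos hb ht (exp_nonpos hk4)
      _ ≤ ∑ k ∈ Finset.Ico 4 (J + 1), ((2 : ℝ) ^ J) ^ ((1 : ℝ) / k - 1 / 3) := by
          refine Finset.sum_le_sum_of_subset_of_nonneg ?_ fun k _ _ ↦ by positivity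
          intro k hk
          rw [Finset.mem_filter, Finset.mem_Icc] at hk
          exact Finset.mem_Ico.2 ⟨hk.1.1, by omega⟩
  · calc ∑ k ∈ (Finset.Icc 4 κ).filter (fun k ↦ ¬k ≤ J), t ^ ((1 : ℝ) / k - 1 / 3)
        ≤ ∑ k ∈ (Finset.Icc 4 κ).filter (fun k ↦ ¬k ≤ J), (2 : ℝ) ^ ((1 : ℝ) - k / 3) := by
          refine Finset.sum_le_sum fun k hk ↦ ?_
          obtain ⟨hkI, -⟩ := Finset.mem_filter.1 hk
          have hk4 : 4 ≤ k := (Finset.mem_Icc.1 hkI).1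
          have hkκ : k ≤ κ := (Finset.mem_Icc.1 hkI).2
          have h2k : (2 : ℝ) ^ k ≤ t := two_pow_le_of_le_floor ht1 hkκ
          have hk0 : (k : ℝ) ≠ 0 := by exact_mod_cast (show k ≠ 0 by omega)
          calc t ^ ((1 : ℝ) / k - 1 / 3) ≤ ((2 : ℝ) ^ k) ^ ((1 : ℝ) / k - 1 / 3) :=
                Real.rpow_le_rpow_of_nonpos (by positivity) h2k (exp_nonpos hk4)
            _ = (2 : ℝ) ^ ((1 : ℝ) - k / 3) := by
                rw [← Real.rpow_natCast (2 : ℝ) k, ← Real.rpow_mul (by norm_num)]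
                congr 1
                field_simp
      _ ≤ ∑ k ∈ Finset.Ico (J + 1) (κ + 1), (2 : ℝ) ^ ((1 : ℝ) - k / 3) := by
          refine Finset.sum_le_sum_of_subset_of_nonneg ?_ fun k _ _ ↦ by positivity
          intro k hk
          rw [Finset.mem_filter, Finset.mem_Icc] at hk
          exact Finset.mem_Ico.2 ⟨by omega, by omega⟩
      _ ≤ 2 * ((2 : ℝ) ^ (-(1 : ℝ) / 3)) ^ (J + 1) / (1 - 0.794) := sum_Ico_two_rpow_le J (κ + 1)

/-- The head for `J = 32`: `∑_{4 ≤ k ≤ 32} (2^{32})^{1/k − 1/3} ≤ 0.32407` (true value `0.31731…`,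
Nicolas's `H(2^{32}) − 1`; terms `k = 4,…,12` singly, `13–16`, `17–20`, `21–32` in blocks).
[cite: Nicolas2012, Lemma 2.4, proof, Case 2 (`H(2^{32}) = 1.31731…`)] -/
theorem sum_Ico_4_33_le :
    ∑ k ∈ Finset.Ico (4 : ℕ) 33, ((2 : ℝ) ^ 32) ^ ((1 : ℝ) / k - 1 / 3) ≤ 0.32407 := by
  set g : ℕ → ℝ := fun k ↦ ((2 : ℝ) ^ 32) ^ ((1 : ℝ) / k - 1 / 3) with hg
  change ∑ k ∈ Finset.Ico 4 33, g k ≤ _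
  have hanti : ∀ {a b : ℕ}, 1 ≤ a → a ≤ b → g b ≤ g a := by
    intro a b ha hab
    simp only [hg]
    refine Real.rpow_le_rpow_of_exponent_le (by norm_num) ?_
    have : (1 : ℝ) / b ≤ 1 / a :=
      one_div_le_one_div_of_le (by exact_mod_cast ha) (by exact_mod_cast hab)
    linarith
  have hblock : ∀ a b : ℕ, 1 ≤ a → ∑ k ∈ Finset.Ico a b, g k ≤ ((b - a : ℕ) : ℝ) * g a := by
    intro a b ha
    have h := Finset.sum_le_card_nsmul (Finset.Ico a b) g (g a) fun k hk ↦ hanti ha (Finset.mem_Ico.1 hk).1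
    rwa [Nat.card_Ico, nsmul_eq_mul] at h
  have h4 : g 4 ≤ 0.1575 := rpow_le_of_pow_le (by norm_num) (by norm_num) (by norm_num)
  have h5 : g 5 ≤ 0.05196 := rpow_le_of_pow_le (by norm_num) (by norm_num) (by norm_num)
  have h6 : g 6 ≤ 0.02481 := rpow_le_of_pow_le (by norm_num) (by norm_num) (by norm_num)
  have h7 : g 7 ≤ 0.01463 := rpow_le_of_pow_le (by norm_num) (by norm_num) (by norm_num)
  have h8 : g 8 ≤ 0.00985 := rpow_le_of_pow_le (by norm_num) (by norm_num) (by norm_num)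
  have h9 : g 9 ≤ 0.00724 := rpow_le_of_pow_le (by norm_num) (by norm_num) (by norm_num)
  have h10 : g 10 ≤ 0.00566 := rpow_le_of_pow_le (by norm_num) (by norm_num) (by norm_num)
  have h11 : g 11 ≤ 0.00463 := rpow_le_of_pow_le (by norm_num) (by norm_num) (by norm_num)
  have h12 : g 12 ≤ 0.00391 := rpow_le_of_pow_le (by norm_num) (by norm_num) (by norm_num)
  have h13 : g 13 ≤ 0.00339 := rpow_le_of_pow_le (by norm_num) (by norm_num) (by norm_num)
  have h17 : g 17 ≤ 0.00227 := rpow_le_of_pow_le (by norm_num) (by norm_num) (by norm_num)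
  have h21 : g 21 ≤ 0.00177 := rpow_le_of_pow_le (by norm_num) (by norm_num) (by norm_num)
  have hsplit : ∑ k ∈ Finset.Ico 4 33, g k = ∑ k ∈ Finset.Ico 4 13, g k + ∑ k ∈ Finset.Ico 13 17, g k +
      ∑ k ∈ Finset.Ico 17 21, g k + ∑ k ∈ Finset.Ico 21 33, g k := by
    rw [Finset.sum_Ico_consecutive _ (by norm_num) (by norm_num),
      Finset.sum_Ico_consecutive _ (by norm_num) (by norm_num),
      Finset.sum_Ico_consecutive _ (by norm_num) (by norm_num)]
  have hsingle : ∑ k ∈ Finset.Ico 4 13, g k = g 4 + g 5 + g 6 + g 7 + g 8 + g 9 + g 10 + g 11 + g 12 := by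
    rw [Finset.sum_Ico_eq_sum_range]
    simp only [Finset.sum_range_succ, Finset.sum_range_zero, zero_add, Nat.reduceSub, Nat.reduceAdd]
  have hb1 := hblock 13 17 (by norm_num)
  have hb2 := hblock 17 21 (by norm_num)
  have hb3 := hblock 21 33 (by norm_num)
  norm_num only [Nat.cast_ofNat] at hb1 hb2 hb3
  rw [hsplit, hsingle]
  linarith

/-- `S₄(t) ≤ 0.3289` for `t ≥ 2^{32}`. [cite: Nicolas2012, Lemma 2.4, proof, Case 2] -/
theorem sum_rpow_sub_third_le_32 {t : ℝ} (ht : (2 : ℝ) ^ 32 ≤ t) :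
    ∑ k ∈ Finset.Icc 4 ⌊Real.log t / Real.log 2⌋₊, t ^ ((1 : ℝ) / k - 1 / 3) ≤ 0.3289 := by
  have h := sum_rpow_sub_third_le ht
  have h1 := sum_Ico_4_33_le
  have h2 := tail_32_le
  simp only [Nat.reduceAdd] at h h1 h2
  linarith

/-- The head for `J = 100`: `∑_{4 ≤ k ≤ 100} (2^{100})^{1/k − 1/3} ≤ 0.01272`. [folklore] -/
theorem sum_Ico_4_101_le :
    ∑ k ∈ Finset.Ico (4 : ℕ) 101, ((2 : ℝ) ^ 100) ^ ((1 : ℝ) / k - 1 / 3) ≤ 0.01272 := by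
  set g : ℕ → ℝ := fun k ↦ ((2 : ℝ) ^ 100) ^ ((1 : ℝ) / k - 1 / 3) with hg
  change ∑ k ∈ Finset.Ico 4 101, g k ≤ _
  have hanti : ∀ {a b : ℕ}, 1 ≤ a → a ≤ b → g b ≤ g a := by
    intro a b ha hab
    simp only [hg]
    refine Real.rpow_le_rpow_of_exponent_le (by norm_num) ?_
    have : (1 : ℝ) / b ≤ 1 / a :=
      one_div_le_one_div_of_le (by exact_mod_cast ha) (by exact_mod_cast hab)
    linarith
  have h4 : g 4 ≤ 0.00312 := rpow_le_of_pow_le (by norm_num) (by norm_num) (by norm_num)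
  have h5 : g 5 ≤ 0.0001 := rpow_le_of_pow_le (by norm_num) (by norm_num) (by norm_num)
  have hblock : ∑ k ∈ Finset.Ico 5 101, g k ≤ ((101 - 5 : ℕ) : ℝ) * g 5 := by
    have h := Finset.sum_le_card_nsmul (Finset.Ico 5 101) g (g 5) fun k hk ↦
      hanti (by norm_num) (Finset.mem_Ico.1 hk).1
    rwa [Nat.card_Ico, nsmul_eq_mul] at h
  norm_num only [Nat.cast_ofNat] at hblock
  rw [Finset.sum_eq_sum_Ico_succ_bot (by norm_num)]
  simp only [Nat.reduceAdd]
  linarith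

/-- `S₄(t) ≤ 0.0128` for `t ≥ 2^{100}`. [folklore] -/
theorem sum_rpow_sub_third_le_100 {t : ℝ} (ht : (2 : ℝ) ^ 100 ≤ t) :
    ∑ k ∈ Finset.Icc 4 ⌊Real.log t / Real.log 2⌋₊, t ^ ((1 : ℝ) / k - 1 / 3) ≤ 0.0128 := by
  have h := sum_rpow_sub_third_le ht
  have h1 := sum_Ico_4_101_le
  have h2 := tail_100_le
  simp only [Nat.reduceAdd] at h h1 h2
  linarith

/-! ### Splitting `ψ − θ = ∑_{2 ≤ k ≤ κ} θ(t^{1/k})` -/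

/-- For `t ≥ 16`: `ψ(t) − θ(t) = θ(t^{1/2}) + θ(t^{1/3}) + ∑_{4 ≤ k ≤ κ(t)} θ(t^{1/k})`.
[cite: Nicolas2012, Lemma 2.4, proof (`ψ(x) − θ(x) = ∑_{k=2}^κ θ(x^{1/k})`)] -/
theorem psi_sub_theta_eq {t : ℝ} (ht : (2 : ℝ) ^ 4 ≤ t) :
    ψ t - θ t = θ (t ^ ((1 : ℝ) / 2)) + θ (t ^ ((1 : ℝ) / 3)) +
      ∑ k ∈ Finset.Icc 4 ⌊Real.log t / Real.log 2⌋₊, θ (t ^ ((1 : ℝ) / k)) := by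
  set κ := ⌊Real.log t / Real.log 2⌋₊ with hκ
  have hκ4 : 4 ≤ κ := le_floor_of_two_pow_le ht
  have ht2 : (2 : ℝ) ≤ t := le_trans (by norm_num) ht
  rw [Chebyshev.psi_eq_theta_add_sum_theta ht2, add_sub_cancel_left]
  have hset : Finset.Icc 2 κ = {2, 3} ∪ Finset.Icc 4 κ := by
    ext k
    simp only [Finset.mem_Icc, Finset.mem_union, Finset.mem_insert, Finset.mem_singleton]
    omega
  have hdisj : Disjoint ({2, 3} : Finset ℕ) (Finset.Icc 4 κ) := by
    rw [Finset.disjoint_left]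
    intro k hk hk'
    simp only [Finset.mem_insert, Finset.mem_singleton] at hk
    rw [Finset.mem_Icc] at hk'
    omega
  rw [hset, Finset.sum_union hdisj, Finset.sum_pair (by norm_num)]
  push_cast
  ring

/-- `∑_{4 ≤ k ≤ κ} t^{1/k} = t^{1/3} · S₄(t)`. [folklore] -/
theorem sum_rpow_eq_mul {t : ℝ} (ht : 0 < t) (s : Finset ℕ) :
    ∑ k ∈ s, t ^ ((1 : ℝ) / k) = t ^ ((1 : ℝ) / 3) * ∑ k ∈ s, t ^ ((1 : ℝ) / k - 1 / 3) := by
  rw [Finset.mul_sum]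
  refine Finset.sum_congr rfl fun k _ ↦ ?_
  rw [← Real.rpow_add ht]
  congr 1
  ring

/-! ### Case 2: `2^{32} ≤ t ≤ 2^{100}` from `θ(y) < y` (`y ≤ 1.39·10^{17}`) -/

/-- **Nicolas 2012, Lemma 2.4 (2.12), Case 2** (with Platt–Trudgian's range in place of Dusart's):
if `θ(y) < y` for `0 < y ≤ 1.39·10^{17}` then `ψ(t) − θ(t) ≤ √t + (4/3) t^{1/3}` for
`2^{32} ≤ t ≤ 2^{100}`. [cite: Nicolas2012, Lemma 2.4 (2.12), proof, Case 2] -/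
theorem psi_sub_theta_le_case2 (hPT : PlattTrudgian2016_theta_lt) {t : ℝ} (ht : (2 : ℝ) ^ 32 ≤ t)
    (ht' : t ≤ (2 : ℝ) ^ 100) :
    ψ t - θ t ≤ Real.sqrt t + 4 / 3 * t ^ ((1 : ℝ) / 3) := by
  set κ := ⌊Real.log t / Real.log 2⌋₊ with hκ
  have ht1 : 1 ≤ t := le_trans (by norm_num) ht
  have ht0 : 0 < t := by linarith
  have h16 : (2 : ℝ) ^ 4 ≤ t := le_trans (by norm_num) ht
  -- every `t^{1/k}`, `k ≥ 2`, is `≤ t^{1/2} ≤ 2^{50} ≤ 1.39·10^{17}`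
  have hroot : ∀ k : ℕ, 2 ≤ k → θ (t ^ ((1 : ℝ) / k)) ≤ t ^ ((1 : ℝ) / k) := by
    intro k hk
    have hy0 : 0 < t ^ ((1 : ℝ) / k) := Real.rpow_pos_of_pos ht0 _
    refine (hPT _ hy0 ?_).le
    calc t ^ ((1 : ℝ) / k) ≤ t ^ ((1 : ℝ) / 2) := by
          refine Real.rpow_le_rpow_of_exponent_le ht1 ?_
          exact one_div_le_one_div_of_le (by norm_num) (by exact_mod_cast hk)
      _ ≤ ((2 : ℝ) ^ 100) ^ ((1 : ℝ) / 2) := Real.rpow_le_rpow ht0.le ht' (by norm_num)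
      _ = (2 : ℝ) ^ 50 := by
          rw [← Real.rpow_natCast 2 100, ← Real.rpow_mul (by norm_num),
            show ((100 : ℕ) : ℝ) * (1 / 2) = ((50 : ℕ) : ℝ) by norm_num, Real.rpow_natCast]
      _ ≤ 139 * 10 ^ 15 := by norm_num
  rw [psi_sub_theta_eq h16]
  have hS := sum_rpow_sub_third_le_32 ht
  have h3 : 0 ≤ t ^ ((1 : ℝ) / 3) := by positivity
  have hsum : ∑ k ∈ Finset.Icc 4 κ, θ (t ^ ((1 : ℝ) / k)) ≤ t ^ ((1 : ℝ) / 3) * 0.3289 := by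
    calc ∑ k ∈ Finset.Icc 4 κ, θ (t ^ ((1 : ℝ) / k)) ≤ ∑ k ∈ Finset.Icc 4 κ, t ^ ((1 : ℝ) / k) :=
          Finset.sum_le_sum fun k hk ↦ hroot k (by linarith [(Finset.mem_Icc.1 hk).1])
      _ = t ^ ((1 : ℝ) / 3) * ∑ k ∈ Finset.Icc 4 κ, t ^ ((1 : ℝ) / k - 1 / 3) := sum_rpow_eq_mul ht0 _
      _ ≤ t ^ ((1 : ℝ) / 3) * 0.3289 := mul_le_mul_of_nonneg_left hS h3
  have h2 := hroot 2 le_rfl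
  have h3' := hroot 3 (by norm_num)
  rw [Real.sqrt_eq_rpow]
  linarith

/-! ### Case 3: `t ≥ 2^{100}` from Schoenfeld's bound -/

/-- `log 2^{100} ≤ 69.315` and `(2^{100})^{1/12} ≥ 322.5`, `(2^{100})^{1/6} ≥ 104000`. [folklore] -/
theorem log_two_pow_100_le : Real.log ((2 : ℝ) ^ 100) ≤ 69.315 := by
  rw [Real.log_pow]
  have := Real.log_two_lt_d9
  push_cast
  linarith

/-- Schoenfeld's excess at `y = t^{1/2}`: `√y log² y/(8π) ≤ 0.15 · t^{1/3}` for `t ≥ 2^{100}`.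
[cite: Nicolas2012, Lemma 2.4, proof, Case 3 (`T(x^{1/2})/x^{1/3}`)] -/
theorem schoenfeld_excess_half_le {t : ℝ} (ht : (2 : ℝ) ^ 100 ≤ t) :
    Real.sqrt (t ^ ((1 : ℝ) / 2)) * Real.log (t ^ ((1 : ℝ) / 2)) ^ 2 / (8 * π) ≤
      0.15 * t ^ ((1 : ℝ) / 3) := by
  have hb : (0 : ℝ) < (2 : ℝ) ^ 100 := by positivity
  have ht0 : 0 < t := hb.trans_le ht
  -- rewrite the left side as `t^{1/3} · (log² t / t^{1/12}) / (32π)`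
  have hsqrt : Real.sqrt (t ^ ((1 : ℝ) / 2)) = t ^ ((1 : ℝ) / 4) := by
    rw [Real.sqrt_eq_rpow, ← Real.rpow_mul ht0.le]; norm_num
  have hlog : Real.log (t ^ ((1 : ℝ) / 2)) = Real.log t / 2 := by
    rw [Real.log_rpow ht0]; ring
  have hquarter : t ^ ((1 : ℝ) / 4) = t ^ ((1 : ℝ) / 3) / t ^ ((1 : ℝ) / 12) := by
    rw [← Real.rpow_sub ht0]; norm_num
  rw [hsqrt, hlog, hquarter]
  -- `log² t / t^{1/12} ≤ log²(2^100)/(2^100)^{1/12} ≤ 69.315²/322.5`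
  have hmono := log_pow_div_rpow_le (a := 1 / 12) (by norm_num) (k := 2) (by norm_num) hb
    (by
      rw [Real.log_pow]
      have := Real.log_two_gt_d9
      push_cast
      linarith) ht
  have hL : Real.log ((2 : ℝ) ^ 100) ^ 2 ≤ 69.315 ^ 2 := by
    have h0 : 0 ≤ Real.log ((2 : ℝ) ^ 100) := Real.log_nonneg (by norm_num)
    exact pow_le_pow_left₀ h0 log_two_pow_100_le 2
  have hR : (322.5 : ℝ) ≤ ((2 : ℝ) ^ 100) ^ ((1 : ℝ) / 12) :=
    le_rpow_of_pow_le (by norm_num) (by norm_num)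
  have hratio : Real.log t ^ 2 / t ^ ((1 : ℝ) / 12) ≤ 69.315 ^ 2 / 322.5 := by
    refine hmono.trans ?_
    calc Real.log ((2 : ℝ) ^ 100) ^ 2 / ((2 : ℝ) ^ 100) ^ ((1 : ℝ) / 12)
        ≤ 69.315 ^ 2 / ((2 : ℝ) ^ 100) ^ ((1 : ℝ) / 12) :=
          div_le_div_of_nonneg_right hL (by positivity)
      _ ≤ 69.315 ^ 2 / 322.5 := div_le_div_of_nonneg_left (by positivity) (by norm_num) hR
  have hπ : (3.141592 : ℝ) < π := Real.pi_gt_d6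
  have h3 : 0 < t ^ ((1 : ℝ) / 3) := Real.rpow_pos_of_pos ht0 _
  have h12 : 0 < t ^ ((1 : ℝ) / 12) := Real.rpow_pos_of_pos ht0 _
  -- `t^{1/3}/t^{1/12} · (log t/2)² /(8π) = t^{1/3} · (log² t/t^{1/12}) / (32 π)`
  have hexpr : t ^ ((1 : ℝ) / 3) / t ^ ((1 : ℝ) / 12) * (Real.log t / 2) ^ 2 / (8 * π) =
      t ^ ((1 : ℝ) / 3) * (Real.log t ^ 2 / t ^ ((1 : ℝ) / 12)) / (32 * π) := by
    field_simp
    ring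
  rw [hexpr, div_le_iff₀ (by positivity)]
  have hnum : (69.315 : ℝ) ^ 2 / 322.5 ≤ 0.15 * (32 * 3.141592) := by norm_num
  calc t ^ ((1 : ℝ) / 3) * (Real.log t ^ 2 / t ^ ((1 : ℝ) / 12))
      ≤ t ^ ((1 : ℝ) / 3) * (69.315 ^ 2 / 322.5) := mul_le_mul_of_nonneg_left hratio h3.le
    _ ≤ t ^ ((1 : ℝ) / 3) * (0.15 * (32 * 3.141592)) := mul_le_mul_of_nonneg_left hnum h3.le
    _ ≤ 0.15 * t ^ ((1 : ℝ) / 3) * (32 * π) := by nlinarith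

/-- Schoenfeld's excess at `y = t^{1/3}`: `√y log² y/(8π) ≤ 0.001 · t^{1/3}` for `t ≥ 2^{100}`.
[cite: Nicolas2012, Lemma 2.4, proof, Case 3 (`T(x^{1/3})/x^{1/3}`)] -/
theorem schoenfeld_excess_third_le {t : ℝ} (ht : (2 : ℝ) ^ 100 ≤ t) :
    Real.sqrt (t ^ ((1 : ℝ) / 3)) * Real.log (t ^ ((1 : ℝ) / 3)) ^ 2 / (8 * π) ≤
      0.001 * t ^ ((1 : ℝ) / 3) := by
  have hb : (0 : ℝ) < (2 : ℝ) ^ 100 := by positivity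
  have ht0 : 0 < t := hb.trans_le ht
  have hsqrt : Real.sqrt (t ^ ((1 : ℝ) / 3)) = t ^ ((1 : ℝ) / 6) := by
    rw [Real.sqrt_eq_rpow, ← Real.rpow_mul ht0.le]; norm_num
  have hlog : Real.log (t ^ ((1 : ℝ) / 3)) = Real.log t / 3 := by
    rw [Real.log_rpow ht0]; ring
  have hsixth : t ^ ((1 : ℝ) / 6) = t ^ ((1 : ℝ) / 3) / t ^ ((1 : ℝ) / 6) := by
    rw [← Real.rpow_sub ht0]; norm_num
  rw [hsqrt, hlog, hsixth]
  have hmono := log_pow_div_rpow_le (a := 1 / 6) (by norm_num) (k := 2) (by norm_num) hb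
    (by
      rw [Real.log_pow]
      have := Real.log_two_gt_d9
      push_cast
      linarith) ht
  have hL : Real.log ((2 : ℝ) ^ 100) ^ 2 ≤ 69.315 ^ 2 := by
    have h0 : 0 ≤ Real.log ((2 : ℝ) ^ 100) := Real.log_nonneg (by norm_num)
    exact pow_le_pow_left₀ h0 log_two_pow_100_le 2
  have hR : (104000 : ℝ) ≤ ((2 : ℝ) ^ 100) ^ ((1 : ℝ) / 6) :=
    le_rpow_of_pow_le (by norm_num) (by norm_num)
  have hratio : Real.log t ^ 2 / t ^ ((1 : ℝ) / 6) ≤ 69.315 ^ 2 / 104000 := by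
    refine hmono.trans ?_
    calc Real.log ((2 : ℝ) ^ 100) ^ 2 / ((2 : ℝ) ^ 100) ^ ((1 : ℝ) / 6)
        ≤ 69.315 ^ 2 / ((2 : ℝ) ^ 100) ^ ((1 : ℝ) / 6) :=
          div_le_div_of_nonneg_right hL (by positivity)
      _ ≤ 69.315 ^ 2 / 104000 := div_le_div_of_nonneg_left (by positivity) (by norm_num) hR
  have hπ : (3.141592 : ℝ) < π := Real.pi_gt_d6
  have h3 : 0 < t ^ ((1 : ℝ) / 3) := Real.rpow_pos_of_pos ht0 _
  have h6 : 0 < t ^ ((1 : ℝ) / 6) := Real.rpow_pos_of_pos ht0 _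
  have hexpr : t ^ ((1 : ℝ) / 3) / t ^ ((1 : ℝ) / 6) * (Real.log t / 3) ^ 2 / (8 * π) =
      t ^ ((1 : ℝ) / 3) * (Real.log t ^ 2 / t ^ ((1 : ℝ) / 6)) / (72 * π) := by
    field_simp
    ring
  rw [hexpr, div_le_iff₀ (by positivity)]
  have hnum : (69.315 : ℝ) ^ 2 / 104000 ≤ 0.001 * (72 * 3.141592) := by norm_num
  calc t ^ ((1 : ℝ) / 3) * (Real.log t ^ 2 / t ^ ((1 : ℝ) / 6))
      ≤ t ^ ((1 : ℝ) / 3) * (69.315 ^ 2 / 104000) := mul_le_mul_of_nonneg_left hratio h3.le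
    _ ≤ t ^ ((1 : ℝ) / 3) * (0.001 * (72 * 3.141592)) := mul_le_mul_of_nonneg_left hnum h3.le
    _ ≤ 0.001 * t ^ ((1 : ℝ) / 3) * (72 * π) := by nlinarith

/-- **Nicolas 2012, Lemma 2.4 (2.12), Case 3** (threshold `2^{100}` in place of `64·10^{22}`): under
RH and Schoenfeld's `θ`-bound, `ψ(t) − θ(t) ≤ √t + (4/3) t^{1/3}` for `t ≥ 2^{100}`; in fact the
coefficient `1 + 0.15 + 0.001 + (log 4)(0.0128) < 1.17` is obtained.
[cite: Nicolas2012, Lemma 2.4 (2.12), proof, Case 3] -/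
theorem psi_sub_theta_le_case3 (hRH : RiemannHypothesis) (hS : Schoenfeld1976_theta) {t : ℝ}
    (ht : (2 : ℝ) ^ 100 ≤ t) :
    ψ t - θ t ≤ Real.sqrt t + 4 / 3 * t ^ ((1 : ℝ) / 3) := by
  set κ := ⌊Real.log t / Real.log 2⌋₊ with hκ
  have hb : (0 : ℝ) < (2 : ℝ) ^ 100 := by positivity
  have ht0 : 0 < t := hb.trans_le ht
  have ht1 : 1 ≤ t := le_trans (by norm_num) ht
  have h16 : (2 : ℝ) ^ 4 ≤ t := le_trans (by norm_num) ht
  have hS' := hS hRH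
  -- `t^{1/2} ≥ 599` and `t^{1/3} ≥ 599`
  have h599 : ∀ n : ℕ, 1 ≤ n → n ≤ 3 → (599 : ℝ) ≤ t ^ ((1 : ℝ) / n) := by
    intro n hn1 hn3
    calc (599 : ℝ) ≤ ((2 : ℝ) ^ 100) ^ ((1 : ℝ) / 3) :=
          le_rpow_of_pow_le (by norm_num) (by norm_num)
      _ ≤ ((2 : ℝ) ^ 100) ^ ((1 : ℝ) / n) := by
          refine Real.rpow_le_rpow_of_exponent_le (by norm_num) ?_
          exact one_div_le_one_div_of_le (by exact_mod_cast hn1) (by exact_mod_cast hn3)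
      _ ≤ t ^ ((1 : ℝ) / n) := Real.rpow_le_rpow hb.le ht (by positivity)
  have hθ2 : θ (t ^ ((1 : ℝ) / 2)) ≤ t ^ ((1 : ℝ) / 2) + 0.15 * t ^ ((1 : ℝ) / 3) := by
    have h := hS' _ (h599 2 (by norm_num) (by norm_num))
    have h' := (abs_le.1 h).2
    linarith [schoenfeld_excess_half_le ht]
  have hθ3 : θ (t ^ ((1 : ℝ) / 3)) ≤ t ^ ((1 : ℝ) / 3) + 0.001 * t ^ ((1 : ℝ) / 3) := by
    have h := hS' _ (h599 3 (by norm_num) (by norm_num))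
    have h' := (abs_le.1 h).2
    linarith [schoenfeld_excess_third_le ht]
  have h3 : 0 ≤ t ^ ((1 : ℝ) / 3) := by positivity
  have hlog4 : Real.log 4 ≤ 1.3863 := by
    rw [show (4 : ℝ) = 2 ^ 2 by norm_num, Real.log_pow]
    have := Real.log_two_lt_d9
    push_cast
    linarith
  have hsum : ∑ k ∈ Finset.Icc 4 κ, θ (t ^ ((1 : ℝ) / k)) ≤ 1.3863 * (t ^ ((1 : ℝ) / 3) * 0.0128) := by
    calc ∑ k ∈ Finset.Icc 4 κ, θ (t ^ ((1 : ℝ) / k)) ≤ ∑ k ∈ Finset.Icc 4 κ, Real.log 4 * t ^ ((1 : ℝ) / k) :=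
          Finset.sum_le_sum fun k _ ↦ Chebyshev.theta_le_log4_mul_x (by positivity)
      _ = Real.log 4 * (t ^ ((1 : ℝ) / 3) * ∑ k ∈ Finset.Icc 4 κ, t ^ ((1 : ℝ) / k - 1 / 3)) := by
          rw [← Finset.mul_sum, sum_rpow_eq_mul ht0]
      _ ≤ Real.log 4 * (t ^ ((1 : ℝ) / 3) * 0.0128) := by
          refine mul_le_mul_of_nonneg_left ?_ (Real.log_nonneg (by norm_num))
          exact mul_le_mul_of_nonneg_left (sum_rpow_sub_third_le_100 ht) h3
      _ ≤ 1.3863 * (t ^ ((1 : ℝ) / 3) * 0.0128) :=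
          mul_le_mul_of_nonneg_right hlog4 (by positivity)
  rw [psi_sub_theta_eq h16, Real.sqrt_eq_rpow]
  linarith

/-! ### Assembly: (2.12) for all `x ≥ 1` -/

/-- **Nicolas 2012, Lemma 2.4, (2.12)** (= Robin 1984, Lemma 3): under the Riemann hypothesis,
`ψ(x) − θ(x) ≤ √x + (4/3) x^{1/3}` for every real `x ≥ 1` — from Schoenfeld's `θ`-bound
(`Schoenfeld1976_theta`), Platt–Trudgian's `θ(y) < y` (`y ≤ 1.39·10^{17}`,
`PlattTrudgian2016_theta_lt`) and the Case-1 computation (`Nicolas2012_lemma24_case1`).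
[cite: Nicolas2012, Lemma 2.4 (2.12)] -/
theorem Nicolas2012_lemma24_upper (hRH : RiemannHypothesis) (hS : Schoenfeld1976_theta)
    (hPT : PlattTrudgian2016_theta_lt) (hC1 : Nicolas2012_lemma24_case1) {x : ℝ} (hx : 1 ≤ x) :
    ψ x - θ x ≤ Real.sqrt x + 4 / 3 * x ^ ((1 : ℝ) / 3) := by
  rcases lt_or_ge x ((2 : ℝ) ^ 32) with h32 | h32
  · have h := hC1 x hx h32
    have h3 : 0 ≤ x ^ ((1 : ℝ) / 3) := by positivity
    nlinarith
  rcases le_or_gt x ((2 : ℝ) ^ 100) with h100 | h100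
  · exact psi_sub_theta_le_case2 hPT h32 h100
  · exact psi_sub_theta_le_case3 hRH hS h100.le

end NicolasPsiTheta

end Literature.NumberTheory.LFunctions
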